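import Literature.NumberTheory.LFunctions.DirichletExplicitRegionComplexPoints
import Literature.Analysis.SpecialFunctions.DigammaBinetLehman
import HarnessLib

/-!
# McCurley's explicit region at complex points: the Gamma terms on vertical lines and the assembled inequality

Topic `Literature/NumberTheory/LFunctions` (namespace `Literature.NumberTheory.LFunctions.McCurleyStechkin`),
continuing `DirichletExplicitRegionComplexPoints.lean` (McCurley 1984 §3 at complex points). Everything
here is PROVED (standard axioms); no definitions, NO named fact.

Source: K. S. McCurley, *Explicit zero-free regions for Dirichlet L-functions*, J. Number Theory **19**
(1984) 7–32 [McCurley1984ZFR], Lemmas 1–2 (pp. 11–14) and §4 (27)–(30) (pp. 22–23).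

* **Lemma 1, analytic part** (`hasSum_re_digamma_vertical`, `re_digamma_mono_abs_im`,
  `re_logDeriv_Gammaℝ_mono_abs_im`, `gammaDiff_le_of_abs_le`): Gauss's series on a vertical line,
  `Re ψ(x+iy) + γ = Σₙ [1/(n+1) − (x+n)/((x+n)²+y²)]`, so "`Re Γ'/Γ(z)` is clearly an increasing
  function of `|y|`" (p. 11); hence for `|t| ≤ T` McCurley's differenced Gamma term
  `gammaDiff a σ t = Re Γℝ'/Γℝ(σ+it+a) − κ Re Γℝ'/Γℝ(σ₁+it+a)` is at most
  `Re Γℝ'/Γℝ(σ+iT+a) − κ Re Γℝ'/Γℝ(σ₁+a)` (his (7): the subtracted term is smallest at `t = 0`).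
* **Lemma 2, analytic part** (`gammaDiff_eq_digamma`, `abs_re_digamma_vertical_sub_le`,
  `gammaDiff_le_stirling`): `gammaDiff = −K log π + ½[Re ψ((σ+a)/2+it/2) − κ Re ψ((σ₁+a)/2+it/2)]`
  and the Stirling sandwich `|Re ψ(x+iy) − ½ log(x²+y²) + x/(2(x²+y²))| ≤ (2/π²)/(x²+y²)` (the
  tree's Lehman Lemma 8, `DigammaLehman.abs_re_digamma_sub_log_norm_add_mul_sq_le`), giving the
  explicit upper bound behind McCurley's (9) (`K log t + c(a,m)` after his simplifications).
  The numerical tables `d(a,m)`, `c(a,m)` are NOT computed here.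
* **(27)–(30) assembled** (`assembled_complex`, `assembled_complex_generic`): for `χ ≠ χ₀` mod `k`,
  `σ > 1`, a zero `β + iγ` of `L(s,χ)` (`β > 0`, `β ≠ ½`) and bounds `Bₘ ≥ f(mγ, χᵐ)` (`m = 2,3,4`;
  Lemma 7's `fAt_one_le` when `χᵐ = χ₀`, Lemma 6's `fAt_induced_le` otherwise):
  `a₁/(σ−β) ≤ a₀ f_{χ₀ mod k}(σ) + a₁[K log k + Γ(a,γ) + Σ_{p∣k} max(G,0)] + a₂B₂ + a₃B₃ + a₄B₄`.
  What remains for Theorem 1 at complex zeros is numerical (Lemmas 1–3 tables, prime sums) plus the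
  casework of §4–§6 in `|γ|` and the optimisation `σ = 1 + r/log M` (`endgame_contra` of
  `DirichletExplicitRegionRealZeros.lean`).

## References

* K. S. McCurley, J. Number Theory 19 (1984) 7–32, doi:10.1016/0022-314x(84)90089-1: Lemma 1 (6)–(8),
  Lemma 2 (9)–(10), §4 (27)–(30). [McCurley1984ZFR]
* R. S. Lehman, *Separation of zeros of the Riemann zeta-function*, Math. Comp. 24 (1970), Lemma 8
  (as vendored in `Literature/Analysis/SpecialFunctions/DigammaBinetLehman.lean`). [Lehman1970]
* G. E. Andrews, R. Askey, R. Roy, *Special Functions*, Thm 1.2.5 (Gauss's series for `ψ`). [AndrewsAskeyRoy1999]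
-/

noncomputable section

open Real Complex

namespace Literature.NumberTheory.LFunctions

namespace McCurleyStechkin

/-! ## The Gamma terms on vertical lines (McCurley's Lemmas 1–2, analytic parts) -/

section GammaVertical

open Literature.Analysis.SpecialFunctions


/-- **Gauss's series on a vertical line, real parts**: for `x > 0` and real `y`,
`Σₙ [1/(n+1) − (x+n)/((x+n)² + y²)] = Re ψ(x + iy) + γ`.
[cite: McCurley1984ZFR, Lemma 1 (proof, (6)–(7))] -/
theorem hasSum_re_digamma_vertical {x : ℝ} (hx : 0 < x) (y : ℝ) :
    HasSum (fun n : ℕ ↦ 1 / ((n : ℝ) + 1) - (x + n) / ((x + n) ^ 2 + y ^ 2))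
      ((Complex.digamma (x + y * I)).re + Real.eulerMascheroniConstant) := by
  have hw : 0 < ((x : ℂ) + y * I).re := by simpa using hx
  have h := Complex.hasSum_re
    (Literature.Analysis.SpecialFunctions.Complex.hasSum_one_div_sub_one_div_digamma hw)
  simp only [add_re, ofReal_re] at h
  refine h.congr_fun fun n ↦ ?_
  have e1 : (1 / ((n : ℂ) + 1)).re = 1 / ((n : ℝ) + 1) := by
    rw [show (1 : ℂ) / ((n : ℂ) + 1) = ((1 / ((n : ℝ) + 1) : ℝ) : ℂ) by push_cast; ring, ofReal_re]
  have e2 : (1 / ((x : ℂ) + y * I + n)).re = (x + n) / ((x + n) ^ 2 + y ^ 2) := by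
    rw [one_div, Complex.inv_re, Complex.normSq_apply]
    simp only [add_re, ofReal_re, mul_re, I_re, mul_zero, ofReal_im, I_im, mul_one, sub_self,
      add_zero, natCast_re, add_im, mul_im, zero_add, natCast_im]
    ring
  rw [sub_re, e1, e2]

/-- **McCurley's Lemma 1, first step: `Re Γ'/Γ(x + iy)` is an increasing function of `|y|`**
(`x > 0`; termwise in Gauss's series). [cite: McCurley1984ZFR, Lemma 1 (proof)] -/
theorem re_digamma_mono_abs_im {x : ℝ} (hx : 0 < x) {y y' : ℝ} (h : |y| ≤ |y'|) :
    (Complex.digamma (x + y * I)).re ≤ (Complex.digamma (x + y' * I)).re := by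
  have h1 := hasSum_re_digamma_vertical hx y
  have h2 := hasSum_re_digamma_vertical hx y'
  have hyy : y ^ 2 ≤ y' ^ 2 := by
    rw [← sq_abs y, ← sq_abs y']; exact pow_le_pow_left₀ (abs_nonneg y) h 2
  have hle := hasSum_le (fun n ↦ ?_) h1 h2
  · linarith
  have hxn : 0 < x + n := by positivity
  have hd : 0 < (x + n) ^ 2 + y ^ 2 := by positivity
  have : (x + n) / ((x + n) ^ 2 + y' ^ 2) ≤ (x + n) / ((x + n) ^ 2 + y ^ 2) :=
    div_le_div_of_nonneg_left hxn.le hd (by linarith)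
  linarith

/-- `Re Γℝ'/Γℝ(x + it)` is an increasing function of `|t|` (`x > 0`):
`Γℝ'/Γℝ(w) = −½ log π + ½ ψ(w/2)`. [cite: McCurley1984ZFR, Lemma 1 (proof)] -/
theorem re_logDeriv_Gammaℝ_mono_abs_im {x : ℝ} (hx : 0 < x) {t t' : ℝ} (h : |t| ≤ |t'|) :
    (logDeriv Gammaℝ ((x : ℂ) + t * I)).re ≤ (logDeriv Gammaℝ ((x : ℂ) + t' * I)).re := by
  have hre : ∀ u : ℝ, 0 < ((x : ℂ) + u * I).re := fun u ↦ by simpa using hx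
  have e : ∀ u : ℝ, (logDeriv Gammaℝ ((x : ℂ) + u * I)).re =
      -(Real.log π) / 2 + (Complex.digamma ((x / 2 : ℝ) + (u / 2 : ℝ) * I)).re / 2 := by
    intro u
    rw [Literature.NumberTheory.LFunctions.logDeriv_Gammaℝ (half_ne_neg_nat_of_re_pos' (hre u)),
      add_re, neg_div, neg_re, div_ofNat_re, div_ofNat_re, ← Complex.ofReal_log Real.pi_pos.le,
      ofReal_re, show ((x : ℂ) + u * I) / 2 = ((x / 2 : ℝ) : ℂ) + ((u / 2 : ℝ) : ℂ) * I by
        push_cast; ring]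
    ring
  rw [e, e]
  have hmono := re_digamma_mono_abs_im (half_pos hx) (y := t / 2) (y' := t' / 2)
    (by rw [abs_div, abs_div, abs_two]; linarith)
  linarith

/-- **McCurley's Lemma 1, reduction to the endpoints.** For `σ > 0`, parity `a`, and `|t| ≤ T`:
`Re Γℝ'/Γℝ(σ+it+a) − κ Re Γℝ'/Γℝ(σ₁+it+a) ≤ Re Γℝ'/Γℝ(σ+iT+a) − κ Re Γℝ'/Γℝ(σ₁+a)`
(the first term increases with `|t|`, the subtracted one is smallest at `t = 0`).
[cite: McCurley1984ZFR, Lemma 1 (proof, (7))] -/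
theorem gammaDiff_le_of_abs_le (a : ℕ) {σ : ℝ} (hσ : 0 < σ) {t T : ℝ} (h : |t| ≤ T) :
    gammaDiff a σ t ≤ (logDeriv Gammaℝ ((σ : ℂ) + T * I + a)).re
      - kappa * (logDeriv Gammaℝ ((sigmaOne σ : ℂ) + a)).re := by
  have hσ₁ : 0 < sigmaOne σ := hσ.trans (lt_sigmaOne hσ)
  have hx : 0 < σ + a := by positivity
  have hx₁ : 0 < sigmaOne σ + a := by positivity
  have e : ∀ (u v : ℝ), ((u : ℂ) + v * I + a) = (((u + a : ℝ)) : ℂ) + v * I := fun u v ↦ by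
    push_cast; ring
  have e0 : ((sigmaOne σ : ℂ) + a) = (((sigmaOne σ + a : ℝ)) : ℂ) + (0 : ℝ) * I := by push_cast; ring
  unfold gammaDiff
  rw [e, e, e, e0]
  have hT : |t| ≤ |T| := h.trans (le_abs_self T)
  have h1 := re_logDeriv_Gammaℝ_mono_abs_im hx hT
  have h2 := re_logDeriv_Gammaℝ_mono_abs_im hx₁ (t := 0) (t' := t) (by rw [abs_zero]; exact abs_nonneg t)
  nlinarith [kappa_pos]


/-- `Γℝ'/Γℝ` differenced, through `ψ`: for `σ > 0`,
`gammaDiff a σ t = −K log π + ½[Re ψ((σ+a)/2 + it/2) − κ Re ψ((σ₁+a)/2 + it/2)]`.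
[cite: McCurley1984ZFR, (13) and Lemmas 1–2] -/
theorem gammaDiff_eq_digamma (a : ℕ) {σ : ℝ} (hσ : 0 < σ) (t : ℝ) :
    gammaDiff a σ t = -bigK * Real.log π
      + ((Complex.digamma ((((σ + a) / 2 : ℝ)) + (t / 2 : ℝ) * I)).re
          - kappa * (Complex.digamma ((((sigmaOne σ + a) / 2 : ℝ)) + (t / 2 : ℝ) * I)).re) / 2 := by
  have hσ₁ : 0 < sigmaOne σ := hσ.trans (lt_sigmaOne hσ)
  have e : ∀ {u : ℝ}, 0 < u → (logDeriv Gammaℝ ((u : ℂ) + t * I + a)).re =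
      -(Real.log π) / 2 + (Complex.digamma ((((u + a) / 2 : ℝ)) + (t / 2 : ℝ) * I)).re / 2 := by
    intro u hu
    have hre : 0 < ((u : ℂ) + t * I + a).re := by simp; positivity
    rw [Literature.NumberTheory.LFunctions.logDeriv_Gammaℝ (half_ne_neg_nat_of_re_pos' hre),
      add_re, neg_div, neg_re, div_ofNat_re, div_ofNat_re, ← Complex.ofReal_log Real.pi_pos.le,
      ofReal_re, show ((u : ℂ) + t * I + a) / 2 = (((u + a) / 2 : ℝ) : ℂ) + ((t / 2 : ℝ) : ℂ) * I by
        push_cast; ring]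
    ring
  unfold gammaDiff bigK
  rw [e hσ, e hσ₁]
  ring

/-- **Stirling on vertical lines (Lehman's Lemma 8, real part), in coordinates.** For `x > 0`,
real `y`: `|Re ψ(x+iy) − ½ log(x²+y²) + x/(2(x²+y²))| ≤ (2/π²)/(x²+y²)`.
[cite: Lehman1970, Lemma 8, p. 308] -/
theorem abs_re_digamma_vertical_sub_le {x : ℝ} (hx : 0 < x) (y : ℝ) :
    |(Complex.digamma (x + y * I)).re - Real.log (x ^ 2 + y ^ 2) / 2 + x / (2 * (x ^ 2 + y ^ 2))| ≤
      2 / π ^ 2 / (x ^ 2 + y ^ 2) := by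
  have hz : 0 < ((x : ℂ) + y * I).re := by simpa using hx
  have h := DigammaLehman.abs_re_digamma_sub_log_norm_add_mul_sq_le hz
  have hn2 : ‖(x : ℂ) + y * I‖ ^ 2 = x ^ 2 + y ^ 2 := by
    rw [Complex.sq_norm, Complex.normSq_apply]
    simp only [add_re, ofReal_re, mul_re, I_re, mul_zero, ofReal_im, I_im, mul_one, sub_self,
      add_zero, add_im, mul_im, zero_add]
    ring
  have hpos : 0 < x ^ 2 + y ^ 2 := by positivity
  have hlog : Real.log ‖(x : ℂ) + y * I‖ = Real.log (x ^ 2 + y ^ 2) / 2 := by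
    rw [← hn2, Real.log_pow, Nat.cast_ofNat]; ring
  have hinv : (1 / (2 * ((x : ℂ) + y * I))).re = x / (2 * (x ^ 2 + y ^ 2)) := by
    rw [one_div, Complex.inv_re, Complex.normSq_apply]
    simp only [mul_re, re_ofNat, add_re, ofReal_re, I_re, mul_zero, ofReal_im, I_im, mul_one,
      sub_self, add_zero, im_ofNat, add_im, mul_im, zero_add, zero_mul, sub_zero]
    have hx0 : x ^ 2 + y ^ 2 ≠ 0 := hpos.ne'
    field_simp
  rw [hlog, hinv, hn2] at h
  rwa [le_div_iff₀ hpos]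

/-- **McCurley's Lemma 2, analytic core (Stirling sandwich for the differenced Gamma term).** For
`σ > 0`, parity `a`, real `t`, with `x = (σ+a)/2`, `x₁ = (σ₁+a)/2`, `y = t/2`:
`gammaDiff a σ t ≤ −K log π + ½[(½ log(x²+y²) − x/(2(x²+y²)) + (2/π²)/(x²+y²))
  − κ(½ log(x₁²+y²) − x₁/(2(x₁²+y²)) − (2/π²)/(x₁²+y²))]`
(McCurley then simplifies this to `K log t + c(a,m)` for `t ≥ 1`, his (9)–(10)).
[cite: McCurley1984ZFR, Lemma 2 (proof, (9))] -/
theorem gammaDiff_le_stirling (a : ℕ) {σ : ℝ} (hσ : 0 < σ) (t : ℝ) :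
    gammaDiff a σ t ≤ -bigK * Real.log π
      + ((Real.log (((σ + a) / 2) ^ 2 + (t / 2) ^ 2) / 2
            - ((σ + a) / 2) / (2 * (((σ + a) / 2) ^ 2 + (t / 2) ^ 2))
            + 2 / π ^ 2 / (((σ + a) / 2) ^ 2 + (t / 2) ^ 2))
          - kappa * (Real.log (((sigmaOne σ + a) / 2) ^ 2 + (t / 2) ^ 2) / 2
            - ((sigmaOne σ + a) / 2) / (2 * (((sigmaOne σ + a) / 2) ^ 2 + (t / 2) ^ 2))
            - 2 / π ^ 2 / (((sigmaOne σ + a) / 2) ^ 2 + (t / 2) ^ 2))) / 2 := by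
  have hσ₁ : 0 < sigmaOne σ := hσ.trans (lt_sigmaOne hσ)
  have hx : 0 < (σ + a) / 2 := by positivity
  have hx₁ : 0 < (sigmaOne σ + a) / 2 := by positivity
  rw [gammaDiff_eq_digamma a hσ t]
  have h1 := abs_le.1 (abs_re_digamma_vertical_sub_le hx (t / 2))
  have h2 := abs_le.1 (abs_re_digamma_vertical_sub_le hx₁ (t / 2))
  nlinarith [kappa_pos, h1.2, h2.1]

end GammaVertical

/-! ## The assembled inequality (27)–(30) at complex points, Gamma and zeta terms symbolic -/

section AssemblyComplex

open DirichletCharacter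

variable {k : ℕ} [NeZero k]

/-- **McCurley's (27)–(30) at complex points, assembled (all analytic terms symbolic).** For any
`χ ≠ χ₀` mod `k` with parity `a`, real `σ > 1`, a zero `ρ = β + iγ` of `L(s, χ)` with `β > 0`,
`β ≠ ½`, and any upper bounds `Bₘ ≥ f(mγ, χᵐ)` for `m = 2, 3, 4` (supplied by `fAt_one_le` when
`χᵐ = χ₀` — Lemma 7 — and by `fAt_induced_le` otherwise — Lemma 6):
`a₁/(σ − β) ≤ a₀ f_{χ₀ mod k}(σ) + a₁[K log k + Γ-terms(a, γ) + Σ_{p∣k} max(G,0)] + a₂B₂ + a₃B₃ + a₄B₄`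
((27) `Σ aₘ f(mγ, χᵐ) ≥ 0` and (29), the kept zero in `f(γ, χ)`). The real-point term
`f_{χ₀ mod k}(σ)` is bounded in `DirichletExplicitRegionRealZeros.lean` (`fdiff_principal_le`); the
Gamma terms by Lemmas 1–2 (`gammaDiff_le_of_abs_le`, `gammaDiff_le_stirling`); `f_ζ(mγ)` by
`fAtZeta_le`. [cite: McCurley1984ZFR, §4 (27)–(30)] -/
theorem assembled_complex (χ : DirichletCharacter ℂ k) (h1 : χ ≠ 1) {σ : ℝ} (hσ : 1 < σ) {ρ : ℂ}
    (hz : χ.LFunction ρ = 0) (h0 : 0 < ρ.re) (hhalf : ρ.re ≠ 1 / 2) {B₂ B₃ B₄ : ℝ}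
    (h₂ : fAt (χ ^ 2) σ (2 * ρ.im) ≤ B₂) (h₃ : fAt (χ ^ 3) σ (3 * ρ.im) ≤ B₃)
    (h₄ : fAt (χ ^ 4) σ (4 * ρ.im) ≤ B₄) :
    rsA1 * (1 / (σ - ρ.re)) ≤ rsA0 * fdiff (1 : DirichletCharacter ℂ k) σ
      + rsA1 * (bigK * Real.log k + gammaDiff (charParity χ) σ ρ.im
          + ∑ p ∈ k.primeFactors, max (gPen p σ) 0)
      + rsA2 * B₂ + rsA3 * B₃ + rsA4 * B₄ := by
  have hP := rosser_positivity_complex χ hσ ρ.im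
  have hm1 := fAt_induced_le_of_zero_im χ h1 hσ hz h0 hhalf
  have ha1 : 0 < rsA1 := by unfold rsA1; norm_num
  have ha2 : 0 < rsA2 := by unfold rsA2; norm_num
  have ha3 : 0 < rsA3 := by unfold rsA3; norm_num
  have ha4 : 0 < rsA4 := by unfold rsA4; norm_num
  nlinarith [mul_le_mul_of_nonneg_left hm1 ha1.le, mul_le_mul_of_nonneg_left h₂ ha2.le,
    mul_le_mul_of_nonneg_left h₃ ha3.le, mul_le_mul_of_nonneg_left h₄ ha4.le]

/-- **The same when no power `χ², χ³, χ⁴` is principal** (`ord χ ≥ 5`, the generic case of §4):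
all three indices take the Lemma 6 bound. [cite: McCurley1984ZFR, §4 (28)–(30)] -/
theorem assembled_complex_generic (χ : DirichletCharacter ℂ k) (h1 : χ ≠ 1) (h2 : χ ^ 2 ≠ 1)
    (h3 : χ ^ 3 ≠ 1) (h4 : χ ^ 4 ≠ 1) {σ : ℝ} (hσ : 1 < σ) {ρ : ℂ} (hz : χ.LFunction ρ = 0)
    (h0 : 0 < ρ.re) (hhalf : ρ.re ≠ 1 / 2) :
    rsA1 * (1 / (σ - ρ.re)) ≤ rsA0 * fdiff (1 : DirichletCharacter ℂ k) σ
      + (rsA1 + rsA2 + rsA3 + rsA4) * (bigK * Real.log k + ∑ p ∈ k.primeFactors, max (gPen p σ) 0)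
      + (rsA1 * gammaDiff (charParity χ) σ ρ.im + rsA2 * gammaDiff (charParity (χ ^ 2)) σ (2 * ρ.im)
        + rsA3 * gammaDiff (charParity (χ ^ 3)) σ (3 * ρ.im)
        + rsA4 * gammaDiff (charParity (χ ^ 4)) σ (4 * ρ.im)) := by
  have h := assembled_complex χ h1 hσ hz h0 hhalf (fAt_induced_le (χ ^ 2) h2 hσ (2 * ρ.im))
    (fAt_induced_le (χ ^ 3) h3 hσ (3 * ρ.im)) (fAt_induced_le (χ ^ 4) h4 hσ (4 * ρ.im))
  linarith

end AssemblyComplex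

end McCurleyStechkin

end Literature.NumberTheory.LFunctions
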